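/-
Copyright (c) 2026 the pub-hodgecm-mathlib formalisation cell (harness21).  Prover seat hodgecm-mathlib-R90-IF-p04 (g2), programme R90-TF, section S9 «InnerForm-13.3.6 (c)»,
deal (e3′) «`hAFS` road» (R90-IF-plan (g2), R90 bus 2026-09-04T23:10:39Z ∕ 23:16:16Z).
-/
import Summits.HodgeConjecture.HodgeConjecture.Theorems.F0P3ArchBlockStructureOfT3         -- ★ #84: `archFinTraceSplit_of_isAdmissibleGK_of_irreducible_unitary` (H3 ⟸ T3 ⟸ Harish-Chandra admissibility BY NAME)
import Literature.NumberTheory.Automorphic.GKModulesAdmissibleUnitaryTwoOne                -- ★ `isAdmissibleGK_of_irreducible_unitary_uFormGroup_two_one` (Harish-Chandra admissibility for `U(2,1)`, PROVED)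
import HarnessLib

/-!
# R90-TF · S9 «InnerForm-13.3.6 (c)» — «ArchFinTraceSplit» HOLDS ON THE FRAME, UNCONDITIONALLY: the letter `hAFS` of the S9 pay line is ★, no socket
# (Flath 1979 Thm. 4; Harish-Chandra 1953 Thms. 4–6 at `U(2,1)`)

Cell `hodgecm-mathlib`, crux H413 (`stmt-HodgeConjecture-24833`, lane `--supports … --as helper`), route of record `HCCMUnconditional` (no route verbs; count-neutral).
Programme R90-TF, section S9 = InnerForm-13.3.6 (c) (base `R90-IF`); seat R90-IF-p04 (g2).  DEALT BY NAME by R90-IF-plan (g2) ((e3′), 23:10:39Z ∕ 23:16:16Z: «`hAFS` road census: ★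
`F0P3ArchFinTraceSplitOfStructure.archFinTraceSplit_of_structure (hH3 : …)` exists — name the cheapest ★ road at B's data and the RESIDUAL LETTER BY NAME ⇒ typ2's row `hAFS` := ★ term
modulo `sock_S9_<letter>_cm` or 0-socket»).  CENSUS RESULT: the cheapest road is ★ #84 `archFinTraceSplit_of_isAdmissibleGK_of_irreducible_unitary (hdef) (h2) (hT3)` (H3 from T3 from
Harish-Chandra's admissibility theorem BY NAME), and its one letter `hT3 : ∀ σ, isAdmissibleGK_of_irreducible_unitary (uFormGroup (Fin 2) (Fin 1)) σ` IS ★ — Literature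
`isAdmissibleGK_of_irreducible_unitary_uFormGroup_two_one` (Gelfand's trick at `U(2,1)`) — so NO residual letter remains: `hAFS` is a THEOREM on the frame (`hdef`: `H` definite at
the complex places off `ι`; `h2 : 2 ≤ [L⁺:ℚ]`), for ANY measures.  This file is that two-line composition, so typ2's row `hAFS` is an in-file term BY NAME and B ED. 4 carries no
`sock_S9_archFinTraceSplit_cm`.  THEOREMS ONLY: no `def`, no instance, no notation, no named fact, no `sorry`; namespace `Summit.HodgeConjecture.HodgeConjecture.R90.S9`.
HONEST LABEL: HC_CM is proved only modulo the 7 printed citations (2 remaining named inputs: hLiu418 = stmt-HodgeConjecture-24832, h413 = stmt-HodgeConjecture-24833) until rung 0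
closes; an assembly of ★ results, no new input.

## What is here (sorry-free, axioms ⊆ {propext, Classical.choice, Quot.sound})
* **`archFinTraceSplit_of_frame`** — `[BorelSpace (Gp L H).Adelic] [IsFiniteMeasureOnCompacts ν] (hdef) (h2) : ArchFinTraceSplit L H ι T hT μ ν νinf μv`.

[cite: FlathCorvallis1979, Thm. 4] [cite: HarishChandra1953, Thms. 4–6] [cite: BorelJacquet1979, §4.3 and §4.6] [cite: GetzHahn2024, §8.5 (8.15) p. 159]
-/

set_option autoImplicit false
set_option linter.dupNamespace false  -- the mandated namespace repeats the summit's segment (`HodgeConjecture.HodgeConjecture`)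

noncomputable section

namespace Summit.HodgeConjecture.HodgeConjecture.R90.S9

open MeasureTheory NumberField IsDedekindDomain
open Literature.NumberTheory.Automorphic Literature.NumberTheory.Automorphic.UnitaryGroup
open Literature.RepresentationTheory.KonnoKonno2007 Literature.RepresentationTheory.KonnoKonno2007.RealDualPair
open Summit.HodgeConjecture.HodgeConjecture.Cruxes.H413.F0P3InnerFormClassificationV6 (Gp Places)
open Summit.HodgeConjecture.HodgeConjecture.Cruxes.H413.F0P3LettersArchFinTraceSplit (ArchFinTraceSplit)
open Summit.HodgeConjecture.HodgeConjecture.Cruxes.H413.F0P3ArchBlockStructureOfT3 (archFinTraceSplit_of_isAdmissibleGK_of_irreducible_unitary)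
open scoped Matrix ComplexOrder

variable (L : Type) [Field L] [NumberField L] [IsCMField L] (H : Matrix (Fin 3) (Fin 3) L) (ι : L →+* ℂ) (T : GL (Fin 3) ℂ)
  (hT : (T : Matrix (Fin 3) (Fin 3) ℂ)ᴴ * H.map ι * (T : Matrix (Fin 3) (Fin 3) ℂ) = Literature.Geometry.ComplexHyperbolic.BallModel.J)
  (μ : Measure (Gp L H).automorphicQuotient) [(Gp L H).IsAutomorphicMeasure μ]
  [MeasurableSpace (Gp L H).Adelic] (ν : Measure (Gp L H).Adelic)
  (νinf : @Measure (UnitaryGroup.arch (↥(maximalRealSubfield L)) L (IsCMField.complexConj L) 3 H) (borel _))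
  (μv : ∀ v : Places L, @Measure ((cmDatum L 3 H).Local v) (borel _))

/-- **«ArchFinTraceSplit» ON THE FRAME, UNCONDITIONALLY** (`hdef`: `H` positive definite at every complex place other than `ι`'s; `h2 : 2 ≤ [L⁺:ℚ]`; `ν` finite on compacts
for the Borel structure): ★ #84 `archFinTraceSplit_of_isAdmissibleGK_of_irreducible_unitary` fed with Harish-Chandra's admissibility theorem for `U(2,1)`, which is ★
(`isAdmissibleGK_of_irreducible_unitary_uFormGroup_two_one`).  The `hAFS` binder of the S9 pay line at `X_cm`, BY NAME. [cite: FlathCorvallis1979, Thm. 4]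
[cite: HarishChandra1953, Thms. 4–6] [cite: BorelJacquet1979, §4.6] -/
theorem archFinTraceSplit_of_frame [BorelSpace (Gp L H).Adelic] [IsFiniteMeasureOnCompacts ν]
    (hdef : ∀ τ' : L →+* ℂ, InfinitePlace.mk τ' ≠ InfinitePlace.mk ι → (H.map τ').PosDef) (h2 : 2 ≤ Module.finrank ℚ ↥(maximalRealSubfield L)) :
    ArchFinTraceSplit L H ι T hT μ ν νinf μv :=
  archFinTraceSplit_of_isAdmissibleGK_of_irreducible_unitary L H ι T hT μ ν νinf μv hdef h2
    fun σ => isAdmissibleGK_of_irreducible_unitary_uFormGroup_two_one σ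

end Summit.HodgeConjecture.HodgeConjecture.R90.S9

end
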